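import Summits.ValiantsHypothesis.ValiantsHypothesis.Theorems.KPlusLogSqLawWeakLiftingBridge
import Summits.ValiantsHypothesis.ValiantsHypothesis.Theorems.LacunarySymmetroidMatrixDescartesLocalMultiplicityFloor

/-!
# `KPlusLogSqLaw` / WeakLifting layer — the LOCAL (multiplicity) census: definitions, the composition
# `LocalParamLaw → LocalLifting → weak LIFT`, and the first census witness `μ(2,3) ≥ 5`

HONEST FRAMING.  Object-search cell `pub-symmetroid` (Valiant), ideator seat val-idea-4 (o-minimal / fewnomial
lens), helper bookkeeping for the OPEN item `WeakLifting` (stmt-ValiantsHypothesis-19561) — line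
`Cruxes/WeakLifting/Lines/local_lifting.lean`.  Nothing here is asserted about `WeakLifting`, `KPlusLogSqLaw`,
`MatrixDescartes` or `VP ≠ VNP`; the two laws `LocalParamLaw`, `LocalLifting` are candidates (NOT asserted) and
appear only as hypotheses.  Sorry-free.

Content:
* `pencilDet`, `LocalRootLawAt m K B` — the local census row «every symmetric lacunary pencil of format `(m,K)` with
  `det ≢ 0` vanishes at `t = 1` to order `≤ B`» (`t = 1` is w.l.o.g. for a non-zero root), `localRootLawAt_mono`;
* candidates `LocalParamLaw` (`μ(m,K) ≤ K·m(m+1)/2`), `LocalLifting` (real row ≤ (local row + 2)·(tropical row + 1)),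
  `PolyWeakLifting` (critic 1's typing, 2026-08-27): `polyWeakLifting_of_local` (PROVED: the first two give the third),
  `factor_le` (`K·m(m+1)/2 + 2 ≤ 2^{4(K + ⌊log₂ m⌋²)}` for `K ≥ 1`), `weakLift_of_polyWeakLifting` (PROVED: the
  polynomial amplitude is inside the weak-LIFT budget, constant 4), `kPlusLogSqLaw_of_polyWeakLifting_of_trop` (PROVED:
  with TB it gives B, via `kPlusLogSqLaw_of_weakLifting_of_tropKPlusLogSqLaw`);
* census witness `det_localWitness23` / `not_localRootLawAt_two_three_four` (PROVED): the integer pencil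
  `[[2,9],[9,38]] + t·[[-3,-9],[-9,-12]] + t³·1` has `det = (t−1)⁵(t+5)`, so `μ(2,3) ≥ 5 = D(2,3)` (the local census
  reaches the Descartes capacity at `(2,3)`; found by the seat's exact Gram search, `exp/levelscan.py`).

HYGIENE REVISION (same day).  The census vocabulary `pencilDet` / `LocalRootLawAt` / `LocalParamLaw` /
`localRootLawAt_mono` and the `(2,3)` witness were landed minutes before this file by
`LacunarySymmetroidMatrixDescartesLocalMultiplicityDefs` / `…LocalMultiplicity` / `…Floor` (namespace
`…Theorems.LacunarySymmetroidMatrixDescartes`, from the same sketch).  Theorems files are append-only, so the copies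
below stay but are DEPRECATED in favour of the canonical ones, and §4 records that the two vocabularies agree
definitionally (`Iff.rfl`) and transports the composition to the canonical vocabulary
(`polyWeakLifting_of_local'`).  New work should use the `…LacunarySymmetroidMatrixDescartes` names.
-/

set_option autoImplicit false

namespace Summit.ValiantsHypothesis.ValiantsHypothesis.Theorems.KPlusLogSqLaw.LocalCensus

open Polynomial
open Summit.ValiantsHypothesis.ValiantsHypothesis.Theorems.LacunarySymmetroidMatrixDescartes (RealRootLawAt KPlusLogSqLaw)
open Summit.ValiantsHypothesis.ValiantsHypothesis.Theorems.LacunarySymmetroidMatrixDescartes.TropicalCensus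

/-! ## 1. The local census row -/

/-- The determinant polynomial of the lacunary pencil `Σ_l X^{d l} • S l` (verbatim the term inside `RealRootLawAt`). [definition of the cell] -/
noncomputable def pencilDet {m K : ℕ} (d : Fin K → ℕ) (S : Fin K → Matrix (Fin m) (Fin m) ℝ) :
    Polynomial ℝ :=
  Matrix.det (∑ l, ((Polynomial.X : Polynomial ℝ) ^ d l) • (S l).map Polynomial.C)

/-- **Local root law at format `(m,K)`**: every symmetric pencil of the format with `det ≢ 0` vanishes at `t = 1`
to order at most `B`. [definition of the cell] -/
def LocalRootLawAt (m K B : ℕ) : Prop :=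
  ∀ (d : Fin K → ℕ) (S : Fin K → Matrix (Fin m) (Fin m) ℝ), (∀ l, (S l).IsSymm) →
    pencilDet d S ≠ 0 → (pencilDet d S).rootMultiplicity 1 ≤ B

/-- monotonicity of the local row in the bound. [folklore] -/
theorem localRootLawAt_mono {m K B B' : ℕ} (hBB' : B ≤ B') (h : LocalRootLawAt m K B) :
    LocalRootLawAt m K B' :=
  fun d S hS h0 => (h d S hS h0).trans hBB'

/-! ## 2. Candidate laws (NOT asserted) and the proved composition -/

/-- **Local parameter law** (candidate of the seat, NOT asserted): `μ(m,K) ≤ K·m(m+1)/2`. [candidate of the cell; no citation exists] -/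
def LocalParamLaw : Prop :=
  ∀ m K : ℕ, LocalRootLawAt m K (K * (m * (m + 1) / 2))

/-- **Local lifting** (candidate of the seat, NOT asserted): real row ≤ (local row + 2)·(tropical row + 1). [candidate of the cell; no citation exists] -/
def LocalLifting : Prop :=
  ∀ m K n B : ℕ, TropRootLawAt m K n → LocalRootLawAt m K B → RealRootLawAt m K ((B + 2) * (n + 1))

/-- **Polynomial-amplitude weak lifting** (candidate typed by critic 1, NOT asserted). [candidate of the cell; no citation exists] -/
def PolyWeakLifting : Prop :=
  ∀ m K n : ℕ, TropRootLawAt m K n → RealRootLawAt m K ((K * (m * (m + 1) / 2) + 2) * (n + 1))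

/-- local parameter law ∧ local lifting ⇒ polynomial weak lifting. [folklore] -/
theorem polyWeakLifting_of_local (hP : LocalParamLaw) (hL : LocalLifting) : PolyWeakLifting :=
  fun m K n hT => hL m K n _ hT (hP m K)

/-- the polynomial amplitude is inside Conjecture B's budget: `K·m(m+1)/2 + 2 ≤ 2^{4(K + ⌊log₂ m⌋²)}` (`K ≥ 1`). [elementary] -/
theorem factor_le (m K : ℕ) (hK : 1 ≤ K) :
    K * (m * (m + 1) / 2) + 2 ≤ 2 ^ (4 * (K + Nat.log 2 m ^ 2)) := by
  set L := Nat.log 2 m with hL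
  have hm : m < 2 ^ (L + 1) := Nat.lt_pow_succ_log_self (by norm_num) m
  have h1 : m * (m + 1) / 2 ≤ 2 ^ (2 * L + 2) :=
    calc m * (m + 1) / 2 ≤ m * (m + 1) := Nat.div_le_self _ _
      _ ≤ 2 ^ (L + 1) * 2 ^ (L + 1) := Nat.mul_le_mul hm.le (Nat.succ_le_of_lt hm)
      _ = 2 ^ (2 * L + 2) := by rw [← pow_add]; ring_nf
  have hK2 : K ≤ 2 ^ K := (Nat.lt_two_pow_self).le
  have h2 : K * (m * (m + 1) / 2) ≤ 2 ^ (K + (2 * L + 2)) := by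
    rw [pow_add]; exact Nat.mul_le_mul hK2 h1
  have h3 : 2 ≤ 2 ^ (K + (2 * L + 2)) :=
    calc 2 = 2 ^ 1 := by norm_num
      _ ≤ 2 ^ (K + (2 * L + 2)) := Nat.pow_le_pow_right (by norm_num) (by omega)
  calc K * (m * (m + 1) / 2) + 2 ≤ 2 ^ (K + (2 * L + 2)) + 2 ^ (K + (2 * L + 2)) := Nat.add_le_add h2 h3
    _ = 2 ^ (K + (2 * L + 2) + 1) := by rw [pow_succ]; ring
    _ ≤ 2 ^ (4 * (K + L ^ 2)) := Nat.pow_le_pow_right (by norm_num) (by nlinarith)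

/-- **polynomial weak lifting ⇒ weak LIFT** (the hypothesis shape of `kPlusLogSqLaw_of_weakLifting_of_tropKPlusLogSqLaw`,
δ-equal to the route item `Theses.KPlusLogSqLaw.WeakLifting`), constant `4`. [folklore] -/
theorem weakLift_of_polyWeakLifting (hW : PolyWeakLifting) :
    ∃ C : ℕ, ∀ m K n : ℕ, TropRootLawAt m K n →
      RealRootLawAt m K (2 ^ (C * (K + Nat.log 2 m ^ 2)) * (n + 1)) := by
  refine ⟨4, fun m K n hT => ?_⟩
  rcases Nat.eq_zero_or_pos K with hK | hK
  · subst hK; exact realRootLawAt_zero m _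
  · exact fun d S hS => (hW m K n hT d S hS).trans (Nat.mul_le_mul_right _ (factor_le m K hK))

/-- **polynomial weak lifting ∧ TB ⇒ B** (census currency). [folklore] -/
theorem kPlusLogSqLaw_of_polyWeakLifting_of_trop (hW : PolyWeakLifting) (hT : TropKPlusLogSqLaw) :
    KPlusLogSqLaw :=
  kPlusLogSqLaw_of_weakLifting_of_tropKPlusLogSqLaw (weakLift_of_polyWeakLifting hW) hT

/-! ## 3. Census witness: `μ(2,3) ≥ 5` -/

/-- the witness support `(0,1,3)`. -/
def dW : Fin 3 → ℕ := ![0, 1, 3]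

/-- the witness letters `[[2,9],[9,38]]`, `[[-3,-9],[-9,-12]]`, `1`. -/
def SW : Fin 3 → Matrix (Fin 2) (Fin 2) ℝ := ![!![2, 9; 9, 38], !![-3, -9; -9, -12], 1]

/-- the witness letters are symmetric. [elementary] -/
theorem SW_isSymm (l : Fin 3) : (SW l).IsSymm := by
  fin_cases l <;> refine Matrix.IsSymm.ext (fun i j => ?_) <;> fin_cases i <;> fin_cases j <;> simp [SW]

/-- `det (SW 0 + t·SW 1 + t³·SW 2) = (t − 1)⁵ (t + 5)`. [elementary] -/
theorem det_localWitness23 : pencilDet dW SW = (X - C 1) ^ 5 * (X + C 5) := by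
  unfold pencilDet
  rw [Fin.sum_univ_three, Matrix.det_fin_two]
  simp [dW, SW, Matrix.smul_apply, Matrix.map_apply, Matrix.add_apply, Polynomial.C_ofNat]
  ring

/-- the witness determinant is not the zero polynomial. [elementary] -/
theorem localWitness23_ne_zero : pencilDet dW SW ≠ 0 := by
  rw [det_localWitness23]
  exact mul_ne_zero (pow_ne_zero _ (X_sub_C_ne_zero 1)) (X_add_C_ne_zero 5)

/-- the witness determinant vanishes at `t = 1` to order exactly `5`. [elementary] -/
theorem rootMultiplicity_localWitness23 : (pencilDet dW SW).rootMultiplicity 1 = 5 := by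
  have hne : (X - C (1:ℝ)) ^ 5 * (X + C 5) ≠ 0 :=
    mul_ne_zero (pow_ne_zero _ (X_sub_C_ne_zero 1)) (X_add_C_ne_zero 5)
  rw [det_localWitness23, Polynomial.rootMultiplicity_mul hne, Polynomial.rootMultiplicity_X_sub_C_pow]
  have h0 : (X + C (5:ℝ)).rootMultiplicity 1 = 0 := by
    rw [Polynomial.rootMultiplicity_eq_zero_iff]
    intro h
    simp at h
    norm_num at h
  rw [h0]

/-- **`μ(2,3) ≥ 5`**: the local row `(2,3)` does not hold with bound `4` — the local census reaches the Descartes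
capacity `D(2,3) = 5` (a 5-fold positive root of a non-degenerate symmetric three-letter `2×2` pencil). [elementary] -/
theorem not_localRootLawAt_two_three_four : ¬ LocalRootLawAt 2 3 4 := by
  intro h
  have h5 := h dW SW SW_isSymm localWitness23_ne_zero
  rw [rootMultiplicity_localWitness23] at h5
  omega

/-! ## 4. Agreement with the canonical census vocabulary (hygiene) -/

section canonical
open Summit.ValiantsHypothesis.ValiantsHypothesis.Theorems

/-- the local row here is definitionally the canonical `LacunarySymmetroidMatrixDescartes.LocalRootLawAt`. [folklore] -/
theorem localRootLawAt_iff_canonical (m K B : ℕ) :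
    LocalRootLawAt m K B ↔ LacunarySymmetroidMatrixDescartes.LocalRootLawAt m K B := Iff.rfl

/-- `LocalParamLaw` here is definitionally the canonical `LacunarySymmetroidMatrixDescartes.LocalParamLaw`. [folklore] -/
theorem localParamLaw_iff_canonical :
    LocalParamLaw ↔ LacunarySymmetroidMatrixDescartes.LocalParamLaw := Iff.rfl

/-- **Local lifting over the canonical vocabulary** (candidate, NOT asserted). [candidate of the cell; no citation exists] -/
def LocalLifting' : Prop :=
  ∀ m K n B : ℕ, TropRootLawAt m K n → LacunarySymmetroidMatrixDescartes.LocalRootLawAt m K B →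
    RealRootLawAt m K ((B + 2) * (n + 1))

/-- the two local-lifting candidates agree definitionally. [folklore] -/
theorem localLifting'_iff : LocalLifting' ↔ LocalLifting := Iff.rfl

/-- canonical form of the composition: `LocalParamLaw ∧ LocalLifting' → PolyWeakLifting`. [folklore] -/
theorem polyWeakLifting_of_local' (hP : LacunarySymmetroidMatrixDescartes.LocalParamLaw) (hL : LocalLifting') :
    PolyWeakLifting :=
  polyWeakLifting_of_local (localParamLaw_iff_canonical.mpr hP) (localLifting'_iff.mp hL)

end canonical

attribute [deprecated Summit.ValiantsHypothesis.ValiantsHypothesis.Theorems.LacunarySymmetroidMatrixDescartes.pencilDet (since := "2026-08-27")] pencilDet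
attribute [deprecated Summit.ValiantsHypothesis.ValiantsHypothesis.Theorems.LacunarySymmetroidMatrixDescartes.LocalRootLawAt (since := "2026-08-27")] LocalRootLawAt
attribute [deprecated Summit.ValiantsHypothesis.ValiantsHypothesis.Theorems.LacunarySymmetroidMatrixDescartes.LocalParamLaw (since := "2026-08-27")] LocalParamLaw
attribute [deprecated Summit.ValiantsHypothesis.ValiantsHypothesis.Theorems.LacunarySymmetroidMatrixDescartes.localRootLawAt_mono (since := "2026-08-27")] localRootLawAt_mono
attribute [deprecated "use Summit.ValiantsHypothesis.ValiantsHypothesis.Theorems.LacunarySymmetroidMatrixDescartes.stub_local_2_3 (LacunarySymmetroidMatrixDescartesLocalMultiplicity)" (since := "2026-08-27")] not_localRootLawAt_two_three_four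
attribute [deprecated LocalLifting' (since := "2026-08-27")] LocalLifting

end Summit.ValiantsHypothesis.ValiantsHypothesis.Theorems.KPlusLogSqLaw.LocalCensus
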